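import Summits.HodgeConjecture.HodgeConjecture.Theorems.AnchorTransportVariationalHodgeTrivialFamily
import Summits.HodgeConjecture.HodgeConjecture.Statement
import Literature.AlgebraicGeometry.HodgeTheory.MotivatedClassesTransport
import Literature.AlgebraicGeometry.HodgeTheory.MotivatedClassesAlgebraic
import Literature.AlgebraicGeometry.HodgeTheory.MotivatedClassesLefschetzRange
import Literature.AlgebraicGeometry.HodgeTheory.HardLefschetzNFoldHolds
import Literature.AlgebraicGeometry.HodgeTheory.LefschetzOneOneHolds
import Literature.AlgebraicGeometry.Motives.AbelianVarietyProjectiveChart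
import HarnessLib

/-!
# Route HeckePrymWeil — `SummitOffWeilSector` (stmt-HodgeConjecture-14374), line `motivated-anchor-split`: motivated anchors from the CONSTANT family

Supporting theorems for Stub 2 `stub_motivatedAnchors` (MOTIVATED ANCHOR EXISTENCE) of the line
skeleton `Cruxes/SummitOffWeilSector/Lines/motivated_anchor_split.lean`: for `X` smooth projective of
dimension `n` and a rational `(p,p)` class `c ∈ H²ᵖ(X(ℂ); ℂ)`, a smooth projective family
`f : 𝒳 ⟶ S`, projective in Hartshorne's sense, over a reduced connected `ℂ`-scheme of finite type,
complex points `s₁, s₀`, an isomorphism `e : X ≅ 𝒳_{s₁}` and a global class `A` with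
`e^*(A|_{𝒳_{s₁}}) = c` and `A|_{𝒳_{s₀}}` MOTIVATED (André 1996, §2.1 Déf. 1). The stub in general is
conjecture-grade ("every Hodge class is motivated", off abelian type). What is proved here:

* `motivatedAnchors_of_mem_motivatedClasses` — the CONSTANT-FAMILY direction: if `c` is already
  motivated on `X`, the constant family `X ⟶ Spec ℂ` (`toSpecOver X`; a smooth projective family by
  `isSmoothProjectiveFamily_toSpecOver'`, all of whose fibre inclusions are isomorphisms,
  `isIso_fiberι_toSpecOver'`), the point `s₁ = s₀ = 𝟙 (Spec ℂ)`, `e := (X_{s₁} ≅ X)⁻¹` and `A := c`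
  are motivated anchors. The projectivity clause is witnessed by `(ι₀, X → Spec ℂ) : X ⟶ ℙᴺ ⊗ Spec ℂ`
  for a projective embedding `ι₀` (`exists_isClosedImmersion_toSpecOver'`: its composite with the
  separated `pr₁` is the closed immersion `ι₀`, `isClosedImmersion_left_lift_toSpecOver`); `Spec ℂ` is
  reduced, connected (irreducible), and its structure map is an isomorphism (`isIso_specOver_hom`),
  hence locally of finite type and quasi-compact; motivatedness moves to the fibre `X_{s₀} ≅ X` by
  `map_mem_motivatedClasses_of_iso`. (Import cone: that of `AnchorTransportVariationalHodgeTrivialFamily`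
  plus the motivated-classes files; the `AnchorTransport` route files are NOT imported.)
* `motivatedAnchors_of_hodgeClassesMotivated` — hence "every Hodge class is motivated" (André's
  conjecture-grade half of `HC ⟺ B ∧ (Hodge ⇒ motivated)`, §0.3) implies Stub 2 VERBATIM; and
  conversely `hodgeClassesMotivated_of_motivatedAnchors` — Stub 2 with André's deformation theorem
  0.5 (`Andre1996_deformation`) gives "every Hodge class is motivated" (the line card's `Transfer`).
* Unconditional cases: `motivatedAnchors_of_mem_algebraicClasses` (algebraic classes — `A(X) ⊆
  A_mot(X)`, André §2.1 remark, with the tree's hard Lefschetz datum `nonempty_hardLefschetzNFold_holds`),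
  `motivatedAnchors_of_hodgeConjecture` (Stub 2 follows from the summit),
  `motivatedAnchors_of_lefschetzRange` (codimensions `p ≤ 1` or `p ≥ n - 1`, by Lefschetz `(1,1)`
  `lefschetzOneOne_rational_holds` and hard Lefschetz), `motivatedAnchors_of_dim_le_three` (EVERY
  smooth projective `X` of dimension `≤ 3`).
* Abelian varieties: `motivatedAnchors_abelianVariety_of_andre` — Stub 2 for every complex abelian
  variety, CONDITIONAL on the named fact `Andre1996_hodgeClasses_abelianVariety_motivated` (André
  Thm. 0.6.2, unproved in the tree); unconditional sub-cases `…_of_dim_le_three`,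
  `…_of_lefschetzRange`, and the reduction `…_of_middle_range` to the codimensions `2 ≤ p ≤ dim − 2`.

Every existential body below is copied verbatim from the stub (so the skeleton can `exact` these).

## References

* [Andre1996Motifs] Y. André, Pour une théorie inconditionnelle des motifs, Publ. Math. IHÉS 83
  (1996) 5–49: §0.3–0.4 (pp. 7–8), Thm. 0.5 (p. 8), Thm. 0.6.2 (p. 9), §2.1 Déf. 1 and remark (p. 14).
* [Hartshorne1977] R. Hartshorne, Algebraic Geometry, GTM 52: II §4 (p. 103, projective morphisms;
  Cor. 4.6), II Ex. 2.7 (points), II.3 (fibres).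
* [VoisinHodgeI2002] C. Voisin, Hodge Theory and Complex Algebraic Geometry I, Thm. 6.25, Thm. 11.30.
-/

noncomputable section

-- every declaration of this problem lives in `Summit.HodgeConjecture.HodgeConjecture.…` (summit = sub-problem)
set_option linter.dupNamespace false

open CategoryTheory AlgebraicGeometry MonoidalCategory CartesianMonoidalCategory
open Literature.AlgebraicGeometry Literature.AlgebraicGeometry.Motives
  Literature.AlgebraicGeometry.HodgeTheory

namespace Summit.HodgeConjecture.HodgeConjecture.Theorems

variable {n : ℕ} {X : SchemeOver ℂ}

/-! ### The base `Spec ℂ` and the projectivity of the constant family `X ⟶ Spec ℂ` -/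

/-- The structure map of `specOver ℂ ℂ` (`Spec` of `algebraMap ℂ ℂ`) is separated. [folklore] -/
theorem isSeparated_specOver_self_hom : IsSeparated (specOver ℂ ℂ).hom := by
  change IsSeparated (Spec.map _)
  infer_instance

/-- `Spec ℂ` is reduced. [folklore] -/
theorem isReduced_specOver_left : IsReduced (specOver ℂ ℂ).left :=
  inferInstanceAs (IsReduced (Spec (CommRingCat.of ℂ)))

/-- `Spec ℂ` is connected (one point; irreducible). [folklore] -/
theorem connectedSpace_specOver_left : ConnectedSpace (specOver ℂ ℂ).left :=
  inferInstanceAs (ConnectedSpace (PrimeSpectrum ℂ))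

/-- The structure map of `specOver ℂ ℂ` is locally of finite type (it is an isomorphism,
`isIso_specOver_hom`). [folklore] -/
theorem locallyOfFiniteType_specOver_hom : LocallyOfFiniteType (specOver ℂ ℂ).hom := by
  haveI := isIso_specOver_hom
  infer_instance

/-- The structure map of `specOver ℂ ℂ` is quasi-compact (it is an isomorphism). [folklore] -/
theorem quasiCompact_specOver_hom : QuasiCompact (specOver ℂ ℂ).hom := by
  haveI := isIso_specOver_hom
  infer_instance

/-- For a closed immersion `ι₀ : X ⟶ ℙᴺ` over `ℂ`, the pairing `(ι₀, X → Spec ℂ) : X ⟶ ℙᴺ ⊗ Spec ℂ`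
is a closed immersion: its composite with the first projection — a base change of the separated
`Spec ℂ → Spec ℂ`, hence separated — is `ι₀`, and closed immersions cancel against separated
morphisms on the right (Mathlib `IsClosedImmersion.of_comp`; Hartshorne II §4, Cor. 4.6 pattern).
[cite: Hartshorne1977, II §4 Cor. 4.6] -/
theorem isClosedImmersion_left_lift_toSpecOver {N : ℕ} (ι₀ : X ⟶ projectiveSpace N ℂ)
    (hι₀ : IsClosedImmersion ι₀.left) : IsClosedImmersion (lift ι₀ (toSpecOver X)).left := by
  have h : IsClosedImmersion
      ((lift ι₀ (toSpecOver X)).left ≫ (fst (projectiveSpace N ℂ) (specOver ℂ ℂ)).left) := by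
    rw [← Over.comp_left, lift_fst]
    exact hι₀
  haveI : IsSeparated (fst (projectiveSpace N ℂ) (specOver ℂ ℂ)).left :=
    MorphismProperty.pullback_fst (P := @IsSeparated) _ _ isSeparated_specOver_self_hom
  exact IsClosedImmersion.of_comp _ (fst (projectiveSpace N ℂ) (specOver ℂ ℂ)).left

/-- **The constant family `X ⟶ Spec ℂ` of a projective `X` is projective in Hartshorne's sense**:
it factors as the closed immersion `(ι₀, X → Spec ℂ) : X ⟶ ℙᴺ ⊗ Spec ℂ`
(`isClosedImmersion_left_lift_toSpecOver`) followed by the projection (Hartshorne II §4, definition of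
a projective morphism, p. 103). Same statement as `exists_isClosedImmersion_toSpecOver` of
`Theorems/AnchorTransportTargetProjectiveRepair`, re-proved here (primed) because that file cannot be
imported without the `AnchorTransport` route's import cone. [cite: Hartshorne1977, II §4 (p. 103)] -/
theorem exists_isClosedImmersion_toSpecOver' (hX : IsProjectiveOver X) :
    ∃ (N : ℕ) (ι : X ⟶ projectiveSpace N ℂ ⊗ specOver ℂ ℂ),
      IsClosedImmersion ι.left ∧ ι ≫ snd (projectiveSpace N ℂ) (specOver ℂ ℂ) = toSpecOver X := by
  obtain ⟨N, ι₀, hι₀⟩ := hX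
  exact ⟨N, lift ι₀ (toSpecOver X), isClosedImmersion_left_lift_toSpecOver ι₀ hι₀, lift_snd _ _⟩

/-! ### Motivated classes have motivated anchors: the constant family -/

/-- **Motivated anchors from the constant family.** If `c ∈ H²ᵖ(X(ℂ); ℂ)` is MOTIVATED on the
smooth projective `X` (`c ∈ A_motᵖ(X)_ℂ = motivatedClasses n X p`, André 1996 §2.1 Déf. 1), then the
data of Stub 2 `stub_motivatedAnchors` exist: the constant family `X ⟶ Spec ℂ` (smooth projective,
`isSmoothProjectiveFamily_toSpecOver'`; projective in Hartshorne's sense,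
`exists_isClosedImmersion_toSpecOver'`; base `Spec ℂ` reduced, connected, of finite type), the complex
point `s₁ = s₀ = 𝟙`, the isomorphism `e = (X_{s₁} ⟶ X)⁻¹` (`isIso_fiberι_toSpecOver'`) and `A := c`:
then `e^* (A|_{X_{s₁}}) = c` and `A|_{X_{s₀}}` is motivated by transport along `X_{s₀} ≅ X`
(`map_mem_motivatedClasses_of_iso`). The existential body is verbatim that of the stub.
[cite: Andre1996Motifs, §2.1 Déf. 1 (p. 14)] -/
theorem motivatedAnchors_of_mem_motivatedClasses (hX : IsSmoothProjective n X) (p : ℕ)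
    (c : complexBetti X (2 * p)) (hc : c ∈ motivatedClasses n X p) :
    ∃ (𝒳 S : SchemeOver ℂ) (f : 𝒳 ⟶ S) (s₁ s₀ : ComplexPoints S) (e : X ≅ fiberOver f s₁)
      (A : complexBetti 𝒳 (2 * p)),
      IsSmoothProjectiveFamily f n ∧
      (∃ (N : ℕ) (ι : 𝒳 ⟶ projectiveSpace N ℂ ⊗ S),
          IsClosedImmersion ι.left ∧ ι ≫ snd (projectiveSpace N ℂ) S = f) ∧
      IsReduced S.left ∧ ConnectedSpace S.left ∧ LocallyOfFiniteType S.hom ∧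
      QuasiCompact S.hom ∧
      complexBetti.map e.hom (2 * p) (complexBetti.map (fiberι f s₁) (2 * p) A) = c ∧
      complexBetti.map (fiberι f s₀) (2 * p) A ∈ motivatedClasses n (fiberOver f s₀) p := by
  have hf : IsSmoothProjectiveFamily (toSpecOver X) n := isSmoothProjectiveFamily_toSpecOver' hX
  haveI := isIso_fiberι_toSpecOver' (X := X) (𝟙 (specOver ℂ ℂ))
  refine ⟨X, specOver ℂ ℂ, toSpecOver X, 𝟙 _, 𝟙 _, (asIso (fiberι (toSpecOver X) (𝟙 _))).symm, c,
    hf, exists_isClosedImmersion_toSpecOver' hX.isProjectiveOver, isReduced_specOver_left,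
    connectedSpace_specOver_left, locallyOfFiniteType_specOver_hom, quasiCompact_specOver_hom,
    ?_, ?_⟩
  · exact complexBetti.map_inv_map_hom_apply (asIso (fiberι (toSpecOver X) (𝟙 _))) (2 * p) c
  · exact map_mem_motivatedClasses_of_iso hX (hf.isSmoothProjective _)
      (asIso (fiberι (toSpecOver X) (𝟙 _))) hc

/-! ### Transfer: "every Hodge class is motivated" versus Stub 2 -/

/-- **"Every Hodge class is motivated" implies Stub 2 verbatim** (the constant family,
`motivatedAnchors_of_mem_motivatedClasses`). The hypothesis is André's conjecture-grade half of
`HC ⟺ B ∧ (Hodge ⇒ motivated)` (§0.3–0.4; a theorem on abelian varieties, Thm. 0.6.2).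
[cite: Andre1996Motifs, §0.4 (p. 8) and §2.1 Déf. 1 (p. 14)] -/
theorem motivatedAnchors_of_hodgeClassesMotivated :
    (∀ ⦃n : ℕ⦄ ⦃X : SchemeOver ℂ⦄, IsSmoothProjective n X →
      ∀ (p : ℕ) (c : complexBetti X (2 * p)), IsRationalClass c → IsOfHodgeType n X (2 * p) p p c →
        c ∈ motivatedClasses n X p) →
    ∀ ⦃n : ℕ⦄ ⦃X : SchemeOver ℂ⦄, IsSmoothProjective n X →
      ∀ (p : ℕ) (c : complexBetti X (2 * p)), IsRationalClass c → IsOfHodgeType n X (2 * p) p p c →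
        ∃ (𝒳 S : SchemeOver ℂ) (f : 𝒳 ⟶ S) (s₁ s₀ : ComplexPoints S) (e : X ≅ fiberOver f s₁)
          (A : complexBetti 𝒳 (2 * p)),
          IsSmoothProjectiveFamily f n ∧
          (∃ (N : ℕ) (ι : 𝒳 ⟶ projectiveSpace N ℂ ⊗ S),
              IsClosedImmersion ι.left ∧ ι ≫ snd (projectiveSpace N ℂ) S = f) ∧
          IsReduced S.left ∧ ConnectedSpace S.left ∧ LocallyOfFiniteType S.hom ∧
          QuasiCompact S.hom ∧
          complexBetti.map e.hom (2 * p) (complexBetti.map (fiberι f s₁) (2 * p) A) = c ∧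
          complexBetti.map (fiberι f s₀) (2 * p) A ∈ motivatedClasses n (fiberOver f s₀) p :=
  fun h _ _ hX p c hc hpp => motivatedAnchors_of_mem_motivatedClasses hX p c (h hX p c hc hpp)

/-- **Conversely, Stub 2 with André's deformation theorem 0.5 gives "every Hodge class is
motivated"**: Thm. 0.5 (`Andre1996_deformation`, hypothesis `hDef`) carries motivatedness from the
anchor fibre `𝒳_{s₀}` to `𝒳_{s₁}`, and iso-invariance (`map_mem_motivatedClasses_of_iso`) across
`e : X ≅ 𝒳_{s₁}` to `c = e^*(A|_{𝒳_{s₁}})`. So, given Thm. 0.5, Stub 2 is EQUIVALENT to the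
motivated half of André's factorisation. [cite: Andre1996Motifs, Thm. 0.5 (p. 8) and §0.4 (p. 8)] -/
theorem hodgeClassesMotivated_of_motivatedAnchors (hDef : Andre1996_deformation)
    (hAn : ∀ ⦃n : ℕ⦄ ⦃X : SchemeOver ℂ⦄, IsSmoothProjective n X →
      ∀ (p : ℕ) (c : complexBetti X (2 * p)), IsRationalClass c → IsOfHodgeType n X (2 * p) p p c →
        ∃ (𝒳 S : SchemeOver ℂ) (f : 𝒳 ⟶ S) (s₁ s₀ : ComplexPoints S) (e : X ≅ fiberOver f s₁)
          (A : complexBetti 𝒳 (2 * p)),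
          IsSmoothProjectiveFamily f n ∧
          (∃ (N : ℕ) (ι : 𝒳 ⟶ projectiveSpace N ℂ ⊗ S),
              IsClosedImmersion ι.left ∧ ι ≫ snd (projectiveSpace N ℂ) S = f) ∧
          IsReduced S.left ∧ ConnectedSpace S.left ∧ LocallyOfFiniteType S.hom ∧
          QuasiCompact S.hom ∧
          complexBetti.map e.hom (2 * p) (complexBetti.map (fiberι f s₁) (2 * p) A) = c ∧
          complexBetti.map (fiberι f s₀) (2 * p) A ∈ motivatedClasses n (fiberOver f s₀) p) :
    ∀ ⦃n : ℕ⦄ ⦃X : SchemeOver ℂ⦄, IsSmoothProjective n X →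
      ∀ (p : ℕ) (c : complexBetti X (2 * p)), IsRationalClass c → IsOfHodgeType n X (2 * p) p p c →
        c ∈ motivatedClasses n X p := by
  intro n X hX p c hc hpp
  obtain ⟨𝒳, S, f, s₁, s₀, e, A, hf, hproj, hred, hconn, hft, hqc, hAc, hs₀⟩ := hAn hX p c hc hpp
  rw [← hAc]
  exact map_mem_motivatedClasses_of_iso (hf.isSmoothProjective s₁) hX e
    (hDef f hf hproj hred hconn hft hqc p A s₀ hs₀ s₁)

/-! ### Unconditional cases: algebraic classes, the Lefschetz range, dimension `≤ 3` -/

/-- **Algebraic classes have motivated anchors, unconditionally**: `A(X) ⊆ A_mot(X)` (André §2.1,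
remark after Déf. 1, the tree's `algebraicClasses_le_motivatedClasses_of_nonempty_hardLefschetzNFold`,
its polarisation input being the tree's THEOREM `nonempty_hardLefschetzNFold_holds` for `X ⊗ X`), then
the constant family. [cite: Andre1996Motifs, §2.1 remark following Déf. 1 (p. 14)] -/
theorem motivatedAnchors_of_mem_algebraicClasses (hX : IsSmoothProjective n X) (p : ℕ)
    (c : complexBetti X (2 * p)) (hc : c ∈ algebraicClasses X p) :
    ∃ (𝒳 S : SchemeOver ℂ) (f : 𝒳 ⟶ S) (s₁ s₀ : ComplexPoints S) (e : X ≅ fiberOver f s₁)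
      (A : complexBetti 𝒳 (2 * p)),
      IsSmoothProjectiveFamily f n ∧
      (∃ (N : ℕ) (ι : 𝒳 ⟶ projectiveSpace N ℂ ⊗ S),
          IsClosedImmersion ι.left ∧ ι ≫ snd (projectiveSpace N ℂ) S = f) ∧
      IsReduced S.left ∧ ConnectedSpace S.left ∧ LocallyOfFiniteType S.hom ∧
      QuasiCompact S.hom ∧
      complexBetti.map e.hom (2 * p) (complexBetti.map (fiberι f s₁) (2 * p) A) = c ∧
      complexBetti.map (fiberι f s₀) (2 * p) A ∈ motivatedClasses n (fiberOver f s₀) p :=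
  motivatedAnchors_of_mem_motivatedClasses hX p c
    (algebraicClasses_le_motivatedClasses_of_nonempty_hardLefschetzNFold hX
      (nonempty_hardLefschetzNFold_holds (n + n) (X ⊗ X)) p hc)

/-- **Stub 2 follows from the Hodge conjecture** (the summit statement `HodgeConjecture`): a
rational `(p,p)` class is then algebraic, and algebraic classes have motivated anchors
(`motivatedAnchors_of_mem_algebraicClasses`). Consistency check: the stub is not refutable short
of refuting the summit. [cite: Andre1996Motifs, §0.3 (p. 7) and §2.1 remark following Déf. 1 (p. 14)] -/
theorem motivatedAnchors_of_hodgeConjecture (h : _root_.HodgeConjecture) :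
    ∀ ⦃n : ℕ⦄ ⦃X : SchemeOver ℂ⦄, IsSmoothProjective n X →
      ∀ (p : ℕ) (c : complexBetti X (2 * p)), IsRationalClass c → IsOfHodgeType n X (2 * p) p p c →
        ∃ (𝒳 S : SchemeOver ℂ) (f : 𝒳 ⟶ S) (s₁ s₀ : ComplexPoints S) (e : X ≅ fiberOver f s₁)
          (A : complexBetti 𝒳 (2 * p)),
          IsSmoothProjectiveFamily f n ∧
          (∃ (N : ℕ) (ι : 𝒳 ⟶ projectiveSpace N ℂ ⊗ S),
              IsClosedImmersion ι.left ∧ ι ≫ snd (projectiveSpace N ℂ) S = f) ∧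
          IsReduced S.left ∧ ConnectedSpace S.left ∧ LocallyOfFiniteType S.hom ∧
          QuasiCompact S.hom ∧
          complexBetti.map e.hom (2 * p) (complexBetti.map (fiberι f s₁) (2 * p) A) = c ∧
          complexBetti.map (fiberι f s₀) (2 * p) A ∈ motivatedClasses n (fiberOver f s₀) p :=
  fun _ _ hX p c hc hpp => motivatedAnchors_of_mem_algebraicClasses hX p c ((h hX).2 p c hc hpp)

/-- **Stub 2 in the Lefschetz range of codimensions, unconditionally**: on a smooth projective
complex `n`-fold, a rational `(p,p)` class with `p ≤ 1` or `n ≤ p + 1` is algebraic (Lefschetz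
`(1,1)`, the tree's theorem `lefschetzOneOne_rational_holds`, and hard Lefschetz,
`nonempty_hardLefschetzNFold_holds`), hence motivated (`mem_motivatedClasses_of_lefschetzRange`), hence
has motivated anchors by the constant family. [cite: VoisinHodgeI2002, Thm. 6.25 and Thm. 11.30]
[cite: Andre1996Motifs, §2.1 remark following Déf. 1 (p. 14)] -/
theorem motivatedAnchors_of_lefschetzRange (hX : IsSmoothProjective n X) {p : ℕ}
    (hp : p ≤ 1 ∨ n ≤ p + 1) (c : complexBetti X (2 * p)) (hc : IsRationalClass c)
    (hpp : IsOfHodgeType n X (2 * p) p p c) :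
    ∃ (𝒳 S : SchemeOver ℂ) (f : 𝒳 ⟶ S) (s₁ s₀ : ComplexPoints S) (e : X ≅ fiberOver f s₁)
      (A : complexBetti 𝒳 (2 * p)),
      IsSmoothProjectiveFamily f n ∧
      (∃ (N : ℕ) (ι : 𝒳 ⟶ projectiveSpace N ℂ ⊗ S),
          IsClosedImmersion ι.left ∧ ι ≫ snd (projectiveSpace N ℂ) S = f) ∧
      IsReduced S.left ∧ ConnectedSpace S.left ∧ LocallyOfFiniteType S.hom ∧
      QuasiCompact S.hom ∧
      complexBetti.map e.hom (2 * p) (complexBetti.map (fiberι f s₁) (2 * p) A) = c ∧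
      complexBetti.map (fiberι f s₀) (2 * p) A ∈ motivatedClasses n (fiberOver f s₀) p :=
  motivatedAnchors_of_mem_motivatedClasses hX p c
    (mem_motivatedClasses_of_lefschetzRange lefschetzOneOne_rational_holds
      (nonempty_hardLefschetzNFold_holds n X) hX hp c hc hpp)

/-- **Stub 2 holds for EVERY smooth projective complex variety of dimension `≤ 3`,
unconditionally** (curves, surfaces, threefolds — abelian or not): every codimension `p` is in the
Lefschetz range `p ≤ 1 ∨ n ≤ p + 1` (`motivatedAnchors_of_lefschetzRange`). The content of the stub
therefore starts in dimension `4`, codimension `2`. [cite: VoisinHodgeI2002, Thm. 6.25 and Thm. 11.30]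
[cite: Andre1996Motifs, §2.1 remark following Déf. 1 (p. 14)] -/
theorem motivatedAnchors_of_dim_le_three (hX : IsSmoothProjective n X) (h3 : n ≤ 3) (p : ℕ)
    (c : complexBetti X (2 * p)) (hc : IsRationalClass c) (hpp : IsOfHodgeType n X (2 * p) p p c) :
    ∃ (𝒳 S : SchemeOver ℂ) (f : 𝒳 ⟶ S) (s₁ s₀ : ComplexPoints S) (e : X ≅ fiberOver f s₁)
      (A : complexBetti 𝒳 (2 * p)),
      IsSmoothProjectiveFamily f n ∧
      (∃ (N : ℕ) (ι : 𝒳 ⟶ projectiveSpace N ℂ ⊗ S),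
          IsClosedImmersion ι.left ∧ ι ≫ snd (projectiveSpace N ℂ) S = f) ∧
      IsReduced S.left ∧ ConnectedSpace S.left ∧ LocallyOfFiniteType S.hom ∧
      QuasiCompact S.hom ∧
      complexBetti.map e.hom (2 * p) (complexBetti.map (fiberι f s₁) (2 * p) A) = c ∧
      complexBetti.map (fiberι f s₀) (2 * p) A ∈ motivatedClasses n (fiberOver f s₀) p :=
  motivatedAnchors_of_lefschetzRange hX (by omega) c hc hpp

/-! ### Abelian varieties (André Thm. 0.6.2) -/

/-- **Stub 2 for complex abelian varieties, CONDITIONAL on André's Thm. 0.6.2** ("tout cycle de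
Hodge sur une variété abélienne est motivé" — the tree's named fact
`Andre1996_hodgeClasses_abelianVariety_motivated`, UNPROVED in the tree, taken as the explicit
hypothesis `h`): for `V` a complex abelian variety (smooth projective of dimension `V.dim` by the
tree's theorem `AbelianVariety.isSmoothProjective_holds`), every rational `(p,p)` class on `V.X` has
motivated anchors — the constant family. This is why the whole Weil sector costs nothing on this
line. [cite: Andre1996Motifs, Thm. 0.6.2 (p. 9)] -/
theorem motivatedAnchors_abelianVariety_of_andre (h : Andre1996_hodgeClasses_abelianVariety_motivated)
    (V : AbelianVariety ℂ) (p : ℕ) (c : complexBetti V.X (2 * p)) (hc : IsRationalClass c)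
    (hpp : IsOfHodgeType V.dim V.X (2 * p) p p c) :
    ∃ (𝒳 S : SchemeOver ℂ) (f : 𝒳 ⟶ S) (s₁ s₀ : ComplexPoints S) (e : V.X ≅ fiberOver f s₁)
      (A : complexBetti 𝒳 (2 * p)),
      IsSmoothProjectiveFamily f V.dim ∧
      (∃ (N : ℕ) (ι : 𝒳 ⟶ projectiveSpace N ℂ ⊗ S),
          IsClosedImmersion ι.left ∧ ι ≫ snd (projectiveSpace N ℂ) S = f) ∧
      IsReduced S.left ∧ ConnectedSpace S.left ∧ LocallyOfFiniteType S.hom ∧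
      QuasiCompact S.hom ∧
      complexBetti.map e.hom (2 * p) (complexBetti.map (fiberι f s₁) (2 * p) A) = c ∧
      complexBetti.map (fiberι f s₀) (2 * p) A ∈ motivatedClasses V.dim (fiberOver f s₀) p :=
  motivatedAnchors_of_mem_motivatedClasses AbelianVariety.isSmoothProjective_holds p c
    (h V AbelianVariety.isSmoothProjective_holds p c hc hpp)

/-- **Stub 2 for abelian varieties of dimension `≤ 3`, unconditionally** (elliptic curves, abelian
surfaces and threefolds: every codimension is in the Lefschetz range; a special case of
`motivatedAnchors_of_dim_le_three`). [cite: Andre1996Motifs, Thm. 0.6.2 (p. 9)]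
[cite: VoisinHodgeI2002, Thm. 6.25 and Thm. 11.30] -/
theorem motivatedAnchors_abelianVariety_of_dim_le_three (V : AbelianVariety ℂ) (h3 : V.dim ≤ 3)
    (p : ℕ) (c : complexBetti V.X (2 * p)) (hc : IsRationalClass c)
    (hpp : IsOfHodgeType V.dim V.X (2 * p) p p c) :
    ∃ (𝒳 S : SchemeOver ℂ) (f : 𝒳 ⟶ S) (s₁ s₀ : ComplexPoints S) (e : V.X ≅ fiberOver f s₁)
      (A : complexBetti 𝒳 (2 * p)),
      IsSmoothProjectiveFamily f V.dim ∧
      (∃ (N : ℕ) (ι : 𝒳 ⟶ projectiveSpace N ℂ ⊗ S),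
          IsClosedImmersion ι.left ∧ ι ≫ snd (projectiveSpace N ℂ) S = f) ∧
      IsReduced S.left ∧ ConnectedSpace S.left ∧ LocallyOfFiniteType S.hom ∧
      QuasiCompact S.hom ∧
      complexBetti.map e.hom (2 * p) (complexBetti.map (fiberι f s₁) (2 * p) A) = c ∧
      complexBetti.map (fiberι f s₀) (2 * p) A ∈ motivatedClasses V.dim (fiberOver f s₀) p :=
  motivatedAnchors_of_dim_le_three AbelianVariety.isSmoothProjective_holds h3 p c hc hpp

/-- **Stub 2 for abelian varieties in the Lefschetz range `p ≤ 1 ∨ dim V ≤ p + 1`,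
unconditionally** (André Thm. 0.6.2 in the codimensions where the class is algebraic; a special
case of `motivatedAnchors_of_lefschetzRange`). [cite: Andre1996Motifs, Thm. 0.6.2 (p. 9)]
[cite: VoisinHodgeI2002, Thm. 6.25 and Thm. 11.30] -/
theorem motivatedAnchors_abelianVariety_of_lefschetzRange (V : AbelianVariety ℂ) {p : ℕ}
    (hp : p ≤ 1 ∨ V.dim ≤ p + 1) (c : complexBetti V.X (2 * p)) (hc : IsRationalClass c)
    (hpp : IsOfHodgeType V.dim V.X (2 * p) p p c) :
    ∃ (𝒳 S : SchemeOver ℂ) (f : 𝒳 ⟶ S) (s₁ s₀ : ComplexPoints S) (e : V.X ≅ fiberOver f s₁)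
      (A : complexBetti 𝒳 (2 * p)),
      IsSmoothProjectiveFamily f V.dim ∧
      (∃ (N : ℕ) (ι : 𝒳 ⟶ projectiveSpace N ℂ ⊗ S),
          IsClosedImmersion ι.left ∧ ι ≫ snd (projectiveSpace N ℂ) S = f) ∧
      IsReduced S.left ∧ ConnectedSpace S.left ∧ LocallyOfFiniteType S.hom ∧
      QuasiCompact S.hom ∧
      complexBetti.map e.hom (2 * p) (complexBetti.map (fiberι f s₁) (2 * p) A) = c ∧
      complexBetti.map (fiberι f s₀) (2 * p) A ∈ motivatedClasses V.dim (fiberOver f s₀) p :=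
  motivatedAnchors_of_lefschetzRange AbelianVariety.isSmoothProjective_holds hp c hc hpp

/-- **Reduction of the abelian case to the middle range**: granted André's Thm. 0.6.2 in the
codimensions `2 ≤ p ≤ dim − 2` only (hypothesis `hmid`; abelian varieties of dimension `≥ 4`, e.g.
Weil classes on abelian fourfolds of Weil type, §6.3 b)), Stub 2 holds for every complex abelian
variety — the Lefschetz range being the tree's theorems (`lefschetzOneOne_rational_holds`,
`nonempty_hardLefschetzNFold_holds`, `Andre1996_hodgeClasses_abelianVariety_motivated_of_middle_range`).
[cite: Andre1996Motifs, Thm. 0.6.2 (p. 9) and §6.3 (pp. 31–33)] -/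
theorem motivatedAnchors_abelianVariety_of_middle_range
    (hmid : ∀ (A : AbelianVariety ℂ) (_ : IsSmoothProjective A.dim A.X) (p : ℕ),
      2 ≤ p → p + 2 ≤ A.dim → ∀ c : complexBetti A.X (2 * p), IsRationalClass c →
        IsOfHodgeType A.dim A.X (2 * p) p p c → c ∈ motivatedClasses A.dim A.X p)
    (V : AbelianVariety ℂ) (p : ℕ) (c : complexBetti V.X (2 * p)) (hc : IsRationalClass c)
    (hpp : IsOfHodgeType V.dim V.X (2 * p) p p c) :
    ∃ (𝒳 S : SchemeOver ℂ) (f : 𝒳 ⟶ S) (s₁ s₀ : ComplexPoints S) (e : V.X ≅ fiberOver f s₁)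
      (A : complexBetti 𝒳 (2 * p)),
      IsSmoothProjectiveFamily f V.dim ∧
      (∃ (N : ℕ) (ι : 𝒳 ⟶ projectiveSpace N ℂ ⊗ S),
          IsClosedImmersion ι.left ∧ ι ≫ snd (projectiveSpace N ℂ) S = f) ∧
      IsReduced S.left ∧ ConnectedSpace S.left ∧ LocallyOfFiniteType S.hom ∧
      QuasiCompact S.hom ∧
      complexBetti.map e.hom (2 * p) (complexBetti.map (fiberι f s₁) (2 * p) A) = c ∧
      complexBetti.map (fiberι f s₀) (2 * p) A ∈ motivatedClasses V.dim (fiberOver f s₀) p :=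
  motivatedAnchors_abelianVariety_of_andre
    (Andre1996_hodgeClasses_abelianVariety_motivated_of_middle_range lefschetzOneOne_rational_holds
      (fun A => nonempty_hardLefschetzNFold_holds A.dim A.X) hmid) V p c hc hpp

end Summit.HodgeConjecture.HodgeConjecture.Theorems

end
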